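import Summits.BirchSwinnertonDyer.BirchSwinnertonDyer.Theorems.ErratumRoadFiveNonSurjCornerFiveInstanceEstar
import HarnessLib

/-!
# Route `ErratumRoadFive` (rung K2), crux `NonSurjCorner` (item stmt-BirchSwinnertonDyer-19065), gen-3 DEEP children
# 23046 `NonSurjCornerKolyZDeep` ∕ 23047 `NonSurjCornerTwinMuAnDeep`: NEW DEEP CORNER PAIRS AT `p = 5` BEYOND THE CENSUS BOX AS KERNEL INSTANCES,
# PART C: `J9t-19o10d149` (`t = -19/10`, `d = 149`) and `J9t-231o115d94` (`t = -231/115`, `d = 94`)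
# (cell `bsd-stepL`, seat `bsd-stepL-corner5-p2` g15, WIDTH-LEVER lane B; `--supports stmt-BirchSwinnertonDyer-23047 --as helper`)

WHY ∕ METHOD: as in parts A ∕ B (p721960 ∕ p722003; template `…FiveInstanceEstar`). Lane B g15's deep hunt, THIRD band (kit j332850: ALL 9 371 root-number −1
members of Zywina's `X_{G₉}` family `j = J₉(t)`, `t = a/b`, `5 ∣ b`, `|a| ≤ 400`, `b ≤ 200`, twists `|d| ≤ 300`, with `10¹² < N ≤ 4·10¹²`; per pair `ellrank` effort 2 → saturation →
ĥ, `ellL1` → `L'(E,1)`, `#Ш_an = X∕ĥ`): 9 029 corner pairs, 6 072 decided, and TEN with `#Ш_an = 25`, each re-verified at 38 digits by kit j333674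
(`ellanalyticrank` = 1 with `L'` = `ellL1` = `lfun`; `ellrank` = `[1, 1, 0]` — rank EXACTLY 1 by 2-descent; generator saturated at every prime ≤ 500; `#Ш_an = 25.000…`).
THIS FILE (part C): the pairs `J9t-19o10d149` and `J9t-231o115d94` as BY-NAME kernel instances — every ALGEBRAIC hypothesis of the deep children decided in the kernel from the literal integer model
(discriminant and `c₄` with factorisations, global minimality by Silverman's bounded criterion — Kraus at `2` where `2¹² ∣ Δ` —, multiplicative reduction at `5` with
`5 ∣ ord₅ Δ_min`, irreducibility of `E[5]` by a Frobenius no-root witness, the multiplicative primes, hence no (ram) witness), `ρ̄_{E,5}` NOT onto a THEOREM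
(`j(E) = J₉(t)`, the tree's `zywina2015_thm14_not_surjective_five_of_j_eq_J9_holds`), the two ANALYTIC hypotheses (`r_an = 1`, `0 < ord₅ #Ш_an`) displayed binders
`hr`, `hSha` in `deepHypotheses` ∕ `twinMuAnDeep_at`.
* `J9t-19o10d149` (namespace `Tm19o10d149`): `t = -19/10`, `[1, -1, 1, -29975513, 182932008281]`, `N = 2583068811210 = 2·3⁴·5·149²·379²`, `ord₅ Δ_min = 5` — a second multiplicative prime `2` with `ord Δ_min = 5` (divisible by 5: no (ram) witness); numerics `L'(E,1) = 54.1238163…`, `ĥ = 3.49926764…`, `X = 87.48169105…`, `#Ш_an = 25.0000…`; first Heegner fields `d_K = -359, -431, -551, -719, …`.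
* `J9t-231o115d94` (namespace `Tm231o115d94`): `t = -231/115`, `[0, 0, 0, -1194733232, -42864018257056]`, `N = 3133304271040 = 2⁶·5·23·47²·439²`, `ord₅ Δ_min = 5` — a second multiplicative prime `23` with `ord Δ_min = 5` (divisible by 5: no (ram) witness); numerics `L'(E,1) = 51.6525312…`, `ĥ = 17.5556978…`, `X = 438.8924455…`, `#Ш_an = 25.0000…`; first Heegner fields `d_K = -359, -631, -751, -919, …`.

HONEST FRAMING: theorems about explicit curves only; no definition, no named fact, no `sorry`; CONDITIONAL only on the displayed analytic binders where they appear;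
nothing is booked; 23046 ∕ 23047 ∕ 19065 stay OPEN (class-wide: Kolyvagin's refined conjecture ∕ Greenberg's Conj. 1.11 at a non-surjective irreducible image with
`p ∥ N`); BSD is proved for no curve; no census word, tier or label moves (T7). Memo `HOME/corner5/g15/CORNER5-P2-G15.md`; data `HOME/corner5/g15/data/hunt5/`
(HUNT5-P3-N4e12.census.tsv), `…/verify10/`. References: as in part A. -/

set_option linter.dupNamespace false
set_option autoImplicit false

noncomputable section
open scoped Classical
open WeierstrassCurve Literature.NumberTheory.EllipticCurves
  Literature.NumberTheory.EllipticCurves.Rank1Residual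
  Literature.NumberTheory.EllipticCurves.Rank1Residual.X11RankOneCertificates
  Summit.BirchSwinnertonDyer.BirchSwinnertonDyer.Rank1Residual.IntModel
  Summit.BirchSwinnertonDyer.Rank1Residual Summit.BirchSwinnertonDyer.Rank1Residual.X11b

namespace Summit.BirchSwinnertonDyer.BirchSwinnertonDyer.Theorems.CornerFive

/-! ## Kernel pair facts of `E₀ = [1, -1, 1, -29975513, 182932008281]` (`J9t-19o10d149`, `j = J₉(-19/10)`, `N = 2583068811210 = 2·3⁴·5·149²·379²`) at `p = 5` -/

namespace Tm19o10d149

/-- `Δ(E₀) = -12731543237550229352100000`. [cite: SilvermanAEC2009, III.1] -/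
theorem Δ_eq : (⟨1, -1, 1, -29975513, 182932008281⟩ : WeierstrassCurve ℤ).Δ = -12731543237550229352100000 := by
  decide

/-- `Δ(E₀) = -2⁵·3⁴·5⁵·149⁶·379²` (bad primes `2, 3, 5, 149, 379`; `N = 2·3⁴·5·149²·379²`). [cite: SilvermanAEC2009, VII.5 Prop. 5.1] -/
theorem Δ_eq_factored : (⟨1, -1, 1, -29975513, 182932008281⟩ : WeierstrassCurve ℤ).Δ =
    -(2 ^ 5 * 3 ^ 4 * 5 ^ 5 * 149 ^ 6 * 379 ^ 2) := by
  rw [Δ_eq]; norm_num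

/-- `c₄(E₀) = 1438824609 = 3²·19·149²·379`. [cite: SilvermanAEC2009, III.1] -/
theorem c₄_eq : (⟨1, -1, 1, -29975513, 182932008281⟩ : WeierstrassCurve ℤ).c₄ = 1438824609 := by
  decide

/-- `#Ẽ₀(𝔽_7) = 8` (`a_7 = 0`), kernel-decided. [cite: SilvermanAEC2009, V.2] -/
theorem card_F7 : Nat.card (((⟨1, -1, 1, -29975513, 182932008281⟩ : WeierstrassCurve ℤ).map
    (Int.castRingHom (ZMod 7))).toAffine.Point) = 8 := by
  rw [@natCard_point_eq_one_add_card (ZMod 7) (@ZMod.instField 7 ⟨by norm_num⟩) _ _ _ (by decide)]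
  decide

/-- `E` is an elliptic curve (`Δ ≠ 0`). [cite: SilvermanAEC2009, III.1] -/
theorem isElliptic (W : WeierstrassCurve ℚ) (hW : W = ⟨1, -1, 1, -29975513, 182932008281⟩) : W.IsElliptic := by
  subst hW; exact isElliptic_of_discOf_ne_zero 1 (-1) 1 (-29975513) 182932008281 (by decide +kernel)

/-- The model is GLOBALLY MINIMAL: `|Δ| < 128¹²` and `q¹² ∤ Δ` for every prime `q < 128` (all `ord_q Δ ≤ 6`).
[cite: SilvermanAEC2009, VII.1 Remark 1.1] -/
theorem isGloballyMinimal (W : WeierstrassCurve ℚ) (hW : W = ⟨1, -1, 1, -29975513, 182932008281⟩) : W.IsGloballyMinimal := by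
  subst hW
  exact CornerSeven.isGloballyMinimal_of_silverman_bounded 1 (-1) 1 (-29975513) 182932008281 128
    (by decide +kernel) (by decide +kernel) (by decide +kernel)

/-- The tree's integral model of `E` is `E₀`. [folklore] -/
theorem integralModelInt_eq (W : WeierstrassCurve ℚ) (hW : W = ⟨1, -1, 1, -29975513, 182932008281⟩) [W.IsGloballyMinimal] :
    integralModelInt W = ⟨1, -1, 1, -29975513, 182932008281⟩ := by
  subst hW; exact integralModelInt_eq_of_map_eq _ (map_mk_int _ _ _ _ _)

/-- `E` as the base change of its integer model. [folklore] -/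
theorem eq_baseChange (W : WeierstrassCurve ℚ) (hW : W = ⟨1, -1, 1, -29975513, 182932008281⟩) :
    W = (⟨1, -1, 1, -29975513, 182932008281⟩ : WeierstrassCurve ℤ).baseChange ℚ := by
  rw [hW]; ext <;> simp [WeierstrassCurve.baseChange, WeierstrassCurve.map]

/-- **Multiplicative reduction at `5`** (`5 ∣ Δ`, `5 ∤ c₄`). [cite: SilvermanAEC2009, VII.5 Prop. 5.1(b)] -/
theorem mult_five (W : WeierstrassCurve ℚ) (hW : W = ⟨1, -1, 1, -29975513, 182932008281⟩) [W.IsElliptic] [W.IsGloballyMinimal]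
    [Fact (Nat.Prime 5)] : Mult W 5 :=
  hasMultiplicativeReductionAtPrime_of_intModel (integralModelInt_eq W hW) 5
    (by rw [Δ_eq]; decide) (by rw [c₄_eq]; decide)

/-- `ord₅ Δ_min(E) = 5`. [cite: SilvermanAEC2009, VII.5 Prop. 5.1(b)] -/
theorem padicValInt_five (W : WeierstrassCurve ℚ) (hW : W = ⟨1, -1, 1, -29975513, 182932008281⟩) [W.IsElliptic] [W.IsGloballyMinimal]
    [Fact (Nat.Prime 5)] : padicValInt 5 W.minimalDiscriminantInt = 5 := by
  rw [minimalDiscriminantInt_eq (integralModelInt_eq W hW), Δ_eq]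
  exact padicValInt_eq_of_dvd_of_not_dvd 5 (by decide) (by decide)

/-- The crux binder **`5 ∣ ord₅ Δ_min(E)`** (`5 = 5·1`). [cite: SilvermanAEC2009, VII.5 Prop. 5.1(b)] -/
theorem dvd_padicValInt_five (W : WeierstrassCurve ℚ) (hW : W = ⟨1, -1, 1, -29975513, 182932008281⟩) [W.IsElliptic] [W.IsGloballyMinimal]
    [Fact (Nat.Prime 5)] : (5 : ℕ) ∣ padicValInt 5 W.minimalDiscriminantInt := by
  have h := padicValInt_five W hW
  omega

/-- `ord_{2} Δ_min(E) = 5` (the second multiplicative prime; `5 ∣ 5`: no (ram) witness). [cite: SilvermanAEC2009, VII.5 Prop. 5.1(b)] -/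
theorem padicValInt_2 (W : WeierstrassCurve ℚ) (hW : W = ⟨1, -1, 1, -29975513, 182932008281⟩) [W.IsElliptic] [W.IsGloballyMinimal] :
    padicValInt 2 W.minimalDiscriminantInt = 5 := by
  haveI : Fact (Nat.Prime 2) := ⟨by norm_num⟩
  rw [minimalDiscriminantInt_eq (integralModelInt_eq W hW), Δ_eq]
  exact padicValInt_eq_of_dvd_of_not_dvd 2 (by decide) (by decide)

/-- **`E[5]` is irreducible**: Frobenius no-root witness at the good prime `ℓ = 7` (`a₇ = 0`, `X² + 7` root-free mod `5`;
Mazur 1978 Prop. 6.3 (1)). [cite: Mazur1978, §6 Prop. 6.3 (1) (p. 153)] -/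
theorem irr_five (W : WeierstrassCurve ℚ) (hW : W = ⟨1, -1, 1, -29975513, 182932008281⟩) [W.IsElliptic] [W.IsGloballyMinimal]
    [Fact (Nat.Prime 5)] : Irr W 5 :=
  haveI : Fact (Nat.Prime 7) := ⟨by norm_num⟩
  hasIrreducibleModPGaloisRep_of_intModel_of_noroot (integralModelInt_eq W hW) 5 7
    (by decide) (by rw [Δ_eq]; decide) card_F7
    (of_decide_eq_true rfl)

/-- **Every prime of multiplicative reduction of `E` is one of `5`, `2`**: it divides `Δ = -2⁵·3⁴·5⁵·149⁶·379²`, and `3`, `149`, `379` are additive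
(`q ∣ Δ`, `q ∣ c₄` at the globally minimal model). [cite: SilvermanAEC2009, VII.5 Prop. 5.1] -/
theorem mem_of_mult (W : WeierstrassCurve ℚ) (hW : W = ⟨1, -1, 1, -29975513, 182932008281⟩) [W.IsElliptic] [W.IsGloballyMinimal]
    {ℓ : ℕ} [hℓ : Fact ℓ.Prime] (hm : Mult W ℓ) : ℓ = 5 ∨ ℓ = 2 := by
  have hI := integralModelInt_eq W hW
  have hdvd : (ℓ : ℤ) ∣ (⟨1, -1, 1, -29975513, 182932008281⟩ : WeierstrassCurve ℤ).Δ := by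
    by_contra hnd
    exact (hasGoodReductionAtPrime_of_not_dvd W ℓ (by rwa [minimalDiscriminantInt_eq hI])).not_hasMultiplicativeReduction _ hm
  rw [Δ_eq_factored, Int.dvd_neg, Int.natCast_dvd] at hdvd
  simp only [Int.natAbs_mul, Int.natAbs_pow] at hdvd
  have hp := hℓ.out
  have hadd : ∀ q : ℕ, [Fact q.Prime] → (q : ℤ) ∣ (⟨1, -1, 1, -29975513, 182932008281⟩ : WeierstrassCurve ℤ).Δ →
      (q : ℤ) ∣ (⟨1, -1, 1, -29975513, 182932008281⟩ : WeierstrassCurve ℤ).c₄ → ¬ Mult W q :=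
    fun q _ hΔ hc ↦ not_hasMultiplicativeReductionAtPrime_of_intModel_of_dvd_of_dvd hI q hΔ hc
  rcases (Nat.Prime.dvd_mul hp).mp hdvd with hdvd | h379
  · rcases (Nat.Prime.dvd_mul hp).mp hdvd with hdvd | h149
    · rcases (Nat.Prime.dvd_mul hp).mp hdvd with hdvd | h5
      · rcases (Nat.Prime.dvd_mul hp).mp hdvd with hdvd | h3
        · exact Or.inr ((Nat.prime_dvd_prime_iff_eq hp (by norm_num : Nat.Prime 2)).mp (hp.dvd_of_dvd_pow hdvd))
        · exfalso
          have h' : ℓ = 3 := (Nat.prime_dvd_prime_iff_eq hp (by norm_num : Nat.Prime 3)).mp (hp.dvd_of_dvd_pow h3)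
          subst h'
          exact hadd 3 (by rw [Δ_eq]; decide) (by rw [c₄_eq]; decide) hm
      · exact Or.inl ((Nat.prime_dvd_prime_iff_eq hp (by norm_num : Nat.Prime 5)).mp (hp.dvd_of_dvd_pow h5))
    · exfalso
      have h' : ℓ = 149 := (Nat.prime_dvd_prime_iff_eq hp (by norm_num : Nat.Prime 149)).mp (hp.dvd_of_dvd_pow h149)
      subst h'
      exact hadd 149 (by rw [Δ_eq]; decide) (by rw [c₄_eq]; decide) hm
  · exfalso
    have h' : ℓ = 379 := (Nat.prime_dvd_prime_iff_eq hp (by norm_num : Nat.Prime 379)).mp (hp.dvd_of_dvd_pow h379)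
    subst h'
    exact hadd 379 (by rw [Δ_eq]; decide) (by rw [c₄_eq]; decide) hm

/-- The crux binder **no (ram) witness at `5`**: the only multiplicative prime `ℓ ≠ 5` is `2`, with `ord_{2} Δ_min = 5`,
divisible by `5`. [cite: SkinnerUrban2014, Thm. 2 (p. 3), hypothesis (ram)] -/
theorem not_ram_five (W : WeierstrassCurve ℚ) (hW : W = ⟨1, -1, 1, -29975513, 182932008281⟩) [W.IsElliptic] [W.IsGloballyMinimal]
    [Fact (Nat.Prime 5)] : ¬ Ram W 5 := by
  rintro ⟨ℓ, hℓ, hne, hm, hv⟩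
  rcases mem_of_mult W hW hm with rfl | rfl
  · exact hne rfl
  · apply hv
    have h := padicValInt_2 W hW
    have hF : hℓ = ⟨by norm_num⟩ := Subsingleton.elim _ _
    subst hF
    omega

/-- **`j(E) = J₉(-19/10)`** on Zywina's `X_{G₉}` j-line: `j = c₄³/Δ = −23396049/100000 = t³(t² + 5t + 40)` at `t = -19/10`.
[cite: Zywina2015, §1.3 (J₉) and Thm. 1.4 (arXiv:1508.07660)] -/
theorem j_eq_J9 (W : WeierstrassCurve ℚ) (hW : W = ⟨1, -1, 1, -29975513, 182932008281⟩) [W.IsElliptic] :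
    W.j = (-19 / 10 : ℚ) ^ 3 * ((-19 / 10 : ℚ) ^ 2 + 5 * (-19 / 10) + 40) := by
  have hW' := eq_baseChange W hW
  subst hW'
  rw [j_baseChange_int, c₄_eq, Δ_eq]; norm_num

/-- **`ρ̄_{E,5}` is NOT onto** — a THEOREM: `E` is non-CM (multiplicative at `5`) and `j(E) = J₉(-19/10)`, so the tree's
`zywina2015_thm14_not_surjective_five_of_j_eq_J9_holds` applies. [cite: Zywina2015, Thm. 1.4 (i = 9) (arXiv:1508.07660)]
[cite: SilvermanATAEC1994, Thm. II.6.4] -/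
theorem not_surj_five (W : WeierstrassCurve ℚ) (hW : W = ⟨1, -1, 1, -29975513, 182932008281⟩) [W.IsElliptic] [W.IsGloballyMinimal]
    [Fact (Nat.Prime 5)] : ¬ Surj W 5 :=
  zywina2015_thm14_not_surjective_five_of_j_eq_J9_holds W
    (fun hCM ↦ not_hasMultiplicativeReductionAtPrime_of_hasCM W hCM 5 (mult_five W hW)) (-19 / 10) (j_eq_J9 W hW)

/-- **`(E, 5) ∈ X11b`** given `r_an(E) = 1` (`hr`; numerics: root number `−1`, `L'(E,1) = 54.1238163…`, `ellrank` = `[1,1,0]`, lane B g15 kit j331690).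
[cite: Miller2011LMS, §1] -/
theorem classX11b_five (W : WeierstrassCurve ℚ) (hW : W = ⟨1, -1, 1, -29975513, 182932008281⟩) [W.IsElliptic] [W.IsGloballyMinimal]
    [Fact (Nat.Prime 5)] (hr : W.analyticRank = 1) : ClassX11b W 5 :=
  ⟨hr, by decide, mult_five W hW, irr_five W hW⟩

/-- **THE DEEP CHILDREN ARE INHABITED AT `(J9t-19o10d149, 5)` modulo two analytic numerics** (`hr : r_an = 1`, `hSha : 0 < ord₅ #Ш_an`; kit j332850 ∕ j333674:
`#Ш(E)_an = 25.000…` at 38 digits): the common outer hypotheses of 23046 ∕ 23047 at `E`. [cite: Zywina2015, Thm. 1.4 (i = 9)] [cite: GrossZagier1986, Thm. I.6.3] -/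
theorem deepHypotheses (W : WeierstrassCurve ℚ) (hW : W = ⟨1, -1, 1, -29975513, 182932008281⟩) [W.IsElliptic]
    [W.IsGloballyMinimal] [Fact (Nat.Prime 5)] (hr : W.analyticRank = 1)
    (hSha : ∃ s : ℚ, shaAn W = (s : ℂ) ∧ 0 < padicValRat 5 s) :
    ClassX11b W 5 ∧ ¬ Surj W 5 ∧ ((5 : ℕ) = 5 ∨ (5 : ℕ) = 7) ∧
      (5 : ℕ) ∣ padicValInt 5 W.minimalDiscriminantInt ∧ ¬ Ram W 5 ∧
      (∃ s : ℚ, shaAn W = (s : ℂ) ∧ 0 < padicValRat 5 s) :=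
  ⟨classX11b_five W hW hr, not_surj_five W hW, Or.inl rfl, dvd_padicValInt_five W hW, not_ram_five W hW, hSha⟩

/-- **What 23047 says at `J9t-19o10d149`** (its inner statement at this pair, for every Heegner field `K` with `L(E^{(d_K)},1) ≠ 0` and every model of
the twist), from the decl BY NAME and the two analytic binders. Nothing is asserted: the decl is a hypothesis. [cite: GreenbergLNM1716, §1 Conj. 1.11 (p. 61) (shape)] -/
theorem twinMuAnDeep_at (h : NonSurjCornerTwinMuAnDeep)
    (W : WeierstrassCurve ℚ) (hW : W = ⟨1, -1, 1, -29975513, 182932008281⟩) [W.IsElliptic] [W.IsGloballyMinimal]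
    [Fact (Nat.Prime 5)] (hr : W.analyticRank = 1) (hSha : ∃ s : ℚ, shaAn W = (s : ℂ) ∧ 0 < padicValRat 5 s)
    (K : Type) [Field K] [NumberField K] (Wd : WeierstrassCurve ℚ) [Wd.IsElliptic] [Wd.IsGloballyMinimal] (Cd : VariableChange ℚ)
    (hK : IsImaginaryQuadratic K) (hH : SatisfiesHeegnerHypothesis (W.conductorNorm ℤ) K)
    (hL : (W.quadraticTwist (NumberField.discr K : ℚ)).entireLFunction 1 ≠ 0)
    (hCd : Cd • W.quadraticTwist (NumberField.discr K : ℚ) = Wd)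
    (hXd : ClassX11a Wd 5) (hnsd : ¬ Surj Wd 5)
    (hvd : (5 : ℕ) ∣ padicValInt 5 Wd.minimalDiscriminantInt)
    {N : ℕ} [NeZero N] (f : CuspForm (CongruenceSubgroup.Gamma0 N) 2) (hf : ModularForms.IsNewformOf Wd f)
    (ϖ : ℚ) (hϖ : (ϖ : ℝ) * Wd.realPeriodRat = ModularForms.plusPeriod f)
    (a : ℚ_[5]) (L : PowerSeries ℚ_[5])
    (ha₁ : Wd.HasSplitMultiplicativeReductionAtPrime 5 → a = 1) (ha₂ : ¬ Wd.HasSplitMultiplicativeReductionAtPrime 5 → a = -1)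
    (hLf : IsMultPAdicLFunctionOf f 5 a L) :
    ∃ n : ℕ, ‖PowerSeries.coeff n (PowerSeries.C ((ϖ : ℚ) : ℚ_[5]) * L)‖ = 1 := by
  obtain ⟨hX, hns, h57, hv, hram, hs⟩ := deepHypotheses W hW hr hSha
  exact h W 5 hX hns h57 hv hram hs K Wd Cd hK hH hL hCd hXd hnsd hvd f hf ϖ hϖ a L ha₁ ha₂ hLf

end Tm19o10d149

/-! ## Kernel pair facts of `E₀ = [0, 0, 0, -1194733232, -42864018257056]` (`J9t-231o115d94`, `j = J₉(-231/115)`, `N = 3133304271040 = 2⁶·5·23·47²·439²`) at `p = 5` -/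

namespace Tm231o115d94

/-- `Δ(E₀) = -684581768749745165091174400000`. [cite: SilvermanAEC2009, III.1] -/
theorem Δ_eq : (⟨0, 0, 0, -1194733232, -42864018257056⟩ : WeierstrassCurve ℤ).Δ = -684581768749745165091174400000 := by
  decide

/-- `Δ(E₀) = -2¹⁴·5⁵·23⁵·47⁶·439²` (bad primes `2, 5, 23, 47, 439`; `N = 2⁶·5·23·47²·439²`). [cite: SilvermanAEC2009, VII.5 Prop. 5.1] -/
theorem Δ_eq_factored : (⟨0, 0, 0, -1194733232, -42864018257056⟩ : WeierstrassCurve ℤ).Δ =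
    -(2 ^ 14 * 5 ^ 5 * 23 ^ 5 * 47 ^ 6 * 439 ^ 2) := by
  rw [Δ_eq]; norm_num

/-- `c₄(E₀) = 57347195136 = 2⁸·3·7·11·47²·439`. [cite: SilvermanAEC2009, III.1] -/
theorem c₄_eq : (⟨0, 0, 0, -1194733232, -42864018257056⟩ : WeierstrassCurve ℤ).c₄ = 57347195136 := by
  decide

/-- `#Ẽ₀(𝔽_3) = 4` (`a_3 = 0`), kernel-decided. [cite: SilvermanAEC2009, V.2] -/
theorem card_F3 : Nat.card (((⟨0, 0, 0, -1194733232, -42864018257056⟩ : WeierstrassCurve ℤ).map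
    (Int.castRingHom (ZMod 3))).toAffine.Point) = 4 := by
  rw [@natCard_point_eq_one_add_card (ZMod 3) (@ZMod.instField 3 ⟨by norm_num⟩) _ _ _ (by decide)]
  decide

/-- `E` is an elliptic curve (`Δ ≠ 0`). [cite: SilvermanAEC2009, III.1] -/
theorem isElliptic (W : WeierstrassCurve ℚ) (hW : W = ⟨0, 0, 0, -1194733232, -42864018257056⟩) : W.IsElliptic := by
  subst hW; exact isElliptic_of_discOf_ne_zero 0 0 0 (-1194733232) (-42864018257056) (by decide +kernel)

/-- The model is GLOBALLY MINIMAL: Silverman's criterion at every odd prime below `512` (all `ord_q Δ < 12` there), `|Δ| < 512¹²`,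
and Kraus's condition at `2` (`2¹⁴ ∥ Δ`, `2⁸ ∥ c₄`, `2¹⁰ ∥ c₆`). [cite: Kraus1989, Prop. 1] [cite: SilvermanAEC2009, VII.1 Remark 1.1] -/
theorem isGloballyMinimal (W : WeierstrassCurve ℚ) (hW : W = ⟨0, 0, 0, -1194733232, -42864018257056⟩) : W.IsGloballyMinimal := by
  subst hW
  exact isGloballyMinimal_of_kraus_two_bounded 0 0 0 (-1194733232) (-42864018257056) 512
    (by decide +kernel) (by decide +kernel) (by decide +kernel) (by decide +kernel)

/-- The tree's integral model of `E` is `E₀`. [folklore] -/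
theorem integralModelInt_eq (W : WeierstrassCurve ℚ) (hW : W = ⟨0, 0, 0, -1194733232, -42864018257056⟩) [W.IsGloballyMinimal] :
    integralModelInt W = ⟨0, 0, 0, -1194733232, -42864018257056⟩ := by
  subst hW; exact integralModelInt_eq_of_map_eq _ (map_mk_int _ _ _ _ _)

/-- `E` as the base change of its integer model. [folklore] -/
theorem eq_baseChange (W : WeierstrassCurve ℚ) (hW : W = ⟨0, 0, 0, -1194733232, -42864018257056⟩) :
    W = (⟨0, 0, 0, -1194733232, -42864018257056⟩ : WeierstrassCurve ℤ).baseChange ℚ := by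
  rw [hW]; ext <;> simp [WeierstrassCurve.baseChange, WeierstrassCurve.map]

/-- **Multiplicative reduction at `5`** (`5 ∣ Δ`, `5 ∤ c₄`). [cite: SilvermanAEC2009, VII.5 Prop. 5.1(b)] -/
theorem mult_five (W : WeierstrassCurve ℚ) (hW : W = ⟨0, 0, 0, -1194733232, -42864018257056⟩) [W.IsElliptic] [W.IsGloballyMinimal]
    [Fact (Nat.Prime 5)] : Mult W 5 :=
  hasMultiplicativeReductionAtPrime_of_intModel (integralModelInt_eq W hW) 5
    (by rw [Δ_eq]; decide) (by rw [c₄_eq]; decide)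

/-- `ord₅ Δ_min(E) = 5`. [cite: SilvermanAEC2009, VII.5 Prop. 5.1(b)] -/
theorem padicValInt_five (W : WeierstrassCurve ℚ) (hW : W = ⟨0, 0, 0, -1194733232, -42864018257056⟩) [W.IsElliptic] [W.IsGloballyMinimal]
    [Fact (Nat.Prime 5)] : padicValInt 5 W.minimalDiscriminantInt = 5 := by
  rw [minimalDiscriminantInt_eq (integralModelInt_eq W hW), Δ_eq]
  exact padicValInt_eq_of_dvd_of_not_dvd 5 (by decide) (by decide)

/-- The crux binder **`5 ∣ ord₅ Δ_min(E)`** (`5 = 5·1`). [cite: SilvermanAEC2009, VII.5 Prop. 5.1(b)] -/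
theorem dvd_padicValInt_five (W : WeierstrassCurve ℚ) (hW : W = ⟨0, 0, 0, -1194733232, -42864018257056⟩) [W.IsElliptic] [W.IsGloballyMinimal]
    [Fact (Nat.Prime 5)] : (5 : ℕ) ∣ padicValInt 5 W.minimalDiscriminantInt := by
  have h := padicValInt_five W hW
  omega

/-- `ord_{23} Δ_min(E) = 5` (the second multiplicative prime; `5 ∣ 5`: no (ram) witness). [cite: SilvermanAEC2009, VII.5 Prop. 5.1(b)] -/
theorem padicValInt_23 (W : WeierstrassCurve ℚ) (hW : W = ⟨0, 0, 0, -1194733232, -42864018257056⟩) [W.IsElliptic] [W.IsGloballyMinimal] :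
    padicValInt 23 W.minimalDiscriminantInt = 5 := by
  haveI : Fact (Nat.Prime 23) := ⟨by norm_num⟩
  rw [minimalDiscriminantInt_eq (integralModelInt_eq W hW), Δ_eq]
  exact padicValInt_eq_of_dvd_of_not_dvd 23 (by decide) (by decide)

/-- **`E[5]` is irreducible**: Frobenius no-root witness at the good prime `ℓ = 3` (`a₃ = 0`, `X² + 3` root-free mod `5`;
Mazur 1978 Prop. 6.3 (1)). [cite: Mazur1978, §6 Prop. 6.3 (1) (p. 153)] -/
theorem irr_five (W : WeierstrassCurve ℚ) (hW : W = ⟨0, 0, 0, -1194733232, -42864018257056⟩) [W.IsElliptic] [W.IsGloballyMinimal]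
    [Fact (Nat.Prime 5)] : Irr W 5 :=
  haveI : Fact (Nat.Prime 3) := ⟨by norm_num⟩
  hasIrreducibleModPGaloisRep_of_intModel_of_noroot (integralModelInt_eq W hW) 5 3
    (by decide) (by rw [Δ_eq]; decide) card_F3
    (of_decide_eq_true rfl)

/-- **Every prime of multiplicative reduction of `E` is one of `5`, `23`**: it divides `Δ = -2¹⁴·5⁵·23⁵·47⁶·439²`, and `2`, `47`, `439` are additive
(`q ∣ Δ`, `q ∣ c₄` at the globally minimal model). [cite: SilvermanAEC2009, VII.5 Prop. 5.1] -/
theorem mem_of_mult (W : WeierstrassCurve ℚ) (hW : W = ⟨0, 0, 0, -1194733232, -42864018257056⟩) [W.IsElliptic] [W.IsGloballyMinimal]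
    {ℓ : ℕ} [hℓ : Fact ℓ.Prime] (hm : Mult W ℓ) : ℓ = 5 ∨ ℓ = 23 := by
  have hI := integralModelInt_eq W hW
  have hdvd : (ℓ : ℤ) ∣ (⟨0, 0, 0, -1194733232, -42864018257056⟩ : WeierstrassCurve ℤ).Δ := by
    by_contra hnd
    exact (hasGoodReductionAtPrime_of_not_dvd W ℓ (by rwa [minimalDiscriminantInt_eq hI])).not_hasMultiplicativeReduction _ hm
  rw [Δ_eq_factored, Int.dvd_neg, Int.natCast_dvd] at hdvd
  simp only [Int.natAbs_mul, Int.natAbs_pow] at hdvd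
  have hp := hℓ.out
  have hadd : ∀ q : ℕ, [Fact q.Prime] → (q : ℤ) ∣ (⟨0, 0, 0, -1194733232, -42864018257056⟩ : WeierstrassCurve ℤ).Δ →
      (q : ℤ) ∣ (⟨0, 0, 0, -1194733232, -42864018257056⟩ : WeierstrassCurve ℤ).c₄ → ¬ Mult W q :=
    fun q _ hΔ hc ↦ not_hasMultiplicativeReductionAtPrime_of_intModel_of_dvd_of_dvd hI q hΔ hc
  rcases (Nat.Prime.dvd_mul hp).mp hdvd with hdvd | h439
  · rcases (Nat.Prime.dvd_mul hp).mp hdvd with hdvd | h47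
    · rcases (Nat.Prime.dvd_mul hp).mp hdvd with hdvd | h23
      · rcases (Nat.Prime.dvd_mul hp).mp hdvd with hdvd | h5
        · exfalso
          have h' : ℓ = 2 := (Nat.prime_dvd_prime_iff_eq hp (by norm_num : Nat.Prime 2)).mp (hp.dvd_of_dvd_pow hdvd)
          subst h'
          exact hadd 2 (by rw [Δ_eq]; decide) (by rw [c₄_eq]; decide) hm
        · exact Or.inl ((Nat.prime_dvd_prime_iff_eq hp (by norm_num : Nat.Prime 5)).mp (hp.dvd_of_dvd_pow h5))
      · exact Or.inr ((Nat.prime_dvd_prime_iff_eq hp (by norm_num : Nat.Prime 23)).mp (hp.dvd_of_dvd_pow h23))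
    · exfalso
      have h' : ℓ = 47 := (Nat.prime_dvd_prime_iff_eq hp (by norm_num : Nat.Prime 47)).mp (hp.dvd_of_dvd_pow h47)
      subst h'
      exact hadd 47 (by rw [Δ_eq]; decide) (by rw [c₄_eq]; decide) hm
  · exfalso
    have h' : ℓ = 439 := (Nat.prime_dvd_prime_iff_eq hp (by norm_num : Nat.Prime 439)).mp (hp.dvd_of_dvd_pow h439)
    subst h'
    exact hadd 439 (by rw [Δ_eq]; decide) (by rw [c₄_eq]; decide) hm

/-- The crux binder **no (ram) witness at `5`**: the only multiplicative prime `ℓ ≠ 5` is `23`, with `ord_{23} Δ_min = 5`,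
divisible by `5`. [cite: SkinnerUrban2014, Thm. 2 (p. 3), hypothesis (ram)] -/
theorem not_ram_five (W : WeierstrassCurve ℚ) (hW : W = ⟨0, 0, 0, -1194733232, -42864018257056⟩) [W.IsElliptic] [W.IsGloballyMinimal]
    [Fact (Nat.Prime 5)] : ¬ Ram W 5 := by
  rintro ⟨ℓ, hℓ, hne, hm, hv⟩
  rcases mem_of_mult W hW hm with rfl | rfl
  · exact hne rfl
  · apply hv
    have h := padicValInt_23 W hW
    have hF : hℓ = ⟨by norm_num⟩ := Subsingleton.elim _ _
    subst hF
    omega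

/-- **`j(E) = J₉(-231/115)`** on Zywina's `X_{G₉}` j-line: `j = c₄³/Δ = −5541156504576/20113571875 = t³(t² + 5t + 40)` at `t = -231/115`.
[cite: Zywina2015, §1.3 (J₉) and Thm. 1.4 (arXiv:1508.07660)] -/
theorem j_eq_J9 (W : WeierstrassCurve ℚ) (hW : W = ⟨0, 0, 0, -1194733232, -42864018257056⟩) [W.IsElliptic] :
    W.j = (-231 / 115 : ℚ) ^ 3 * ((-231 / 115 : ℚ) ^ 2 + 5 * (-231 / 115) + 40) := by
  have hW' := eq_baseChange W hW
  subst hW'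
  rw [j_baseChange_int, c₄_eq, Δ_eq]; norm_num

/-- **`ρ̄_{E,5}` is NOT onto** — a THEOREM: `E` is non-CM (multiplicative at `5`) and `j(E) = J₉(-231/115)`, so the tree's
`zywina2015_thm14_not_surjective_five_of_j_eq_J9_holds` applies. [cite: Zywina2015, Thm. 1.4 (i = 9) (arXiv:1508.07660)]
[cite: SilvermanATAEC1994, Thm. II.6.4] -/
theorem not_surj_five (W : WeierstrassCurve ℚ) (hW : W = ⟨0, 0, 0, -1194733232, -42864018257056⟩) [W.IsElliptic] [W.IsGloballyMinimal]
    [Fact (Nat.Prime 5)] : ¬ Surj W 5 :=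
  zywina2015_thm14_not_surjective_five_of_j_eq_J9_holds W
    (fun hCM ↦ not_hasMultiplicativeReductionAtPrime_of_hasCM W hCM 5 (mult_five W hW)) (-231 / 115) (j_eq_J9 W hW)

/-- **`(E, 5) ∈ X11b`** given `r_an(E) = 1` (`hr`; numerics: root number `−1`, `L'(E,1) = 51.6525312…`, `ellrank` = `[1,1,0]`, lane B g15 kit j331690).
[cite: Miller2011LMS, §1] -/
theorem classX11b_five (W : WeierstrassCurve ℚ) (hW : W = ⟨0, 0, 0, -1194733232, -42864018257056⟩) [W.IsElliptic] [W.IsGloballyMinimal]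
    [Fact (Nat.Prime 5)] (hr : W.analyticRank = 1) : ClassX11b W 5 :=
  ⟨hr, by decide, mult_five W hW, irr_five W hW⟩

/-- **THE DEEP CHILDREN ARE INHABITED AT `(J9t-231o115d94, 5)` modulo two analytic numerics** (`hr : r_an = 1`, `hSha : 0 < ord₅ #Ш_an`; kit j332850 ∕ j333674:
`#Ш(E)_an = 25.000…` at 38 digits): the common outer hypotheses of 23046 ∕ 23047 at `E`. [cite: Zywina2015, Thm. 1.4 (i = 9)] [cite: GrossZagier1986, Thm. I.6.3] -/
theorem deepHypotheses (W : WeierstrassCurve ℚ) (hW : W = ⟨0, 0, 0, -1194733232, -42864018257056⟩) [W.IsElliptic]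
    [W.IsGloballyMinimal] [Fact (Nat.Prime 5)] (hr : W.analyticRank = 1)
    (hSha : ∃ s : ℚ, shaAn W = (s : ℂ) ∧ 0 < padicValRat 5 s) :
    ClassX11b W 5 ∧ ¬ Surj W 5 ∧ ((5 : ℕ) = 5 ∨ (5 : ℕ) = 7) ∧
      (5 : ℕ) ∣ padicValInt 5 W.minimalDiscriminantInt ∧ ¬ Ram W 5 ∧
      (∃ s : ℚ, shaAn W = (s : ℂ) ∧ 0 < padicValRat 5 s) :=
  ⟨classX11b_five W hW hr, not_surj_five W hW, Or.inl rfl, dvd_padicValInt_five W hW, not_ram_five W hW, hSha⟩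

/-- **What 23047 says at `J9t-231o115d94`** (its inner statement at this pair, for every Heegner field `K` with `L(E^{(d_K)},1) ≠ 0` and every model of
the twist), from the decl BY NAME and the two analytic binders. Nothing is asserted: the decl is a hypothesis. [cite: GreenbergLNM1716, §1 Conj. 1.11 (p. 61) (shape)] -/
theorem twinMuAnDeep_at (h : NonSurjCornerTwinMuAnDeep)
    (W : WeierstrassCurve ℚ) (hW : W = ⟨0, 0, 0, -1194733232, -42864018257056⟩) [W.IsElliptic] [W.IsGloballyMinimal]
    [Fact (Nat.Prime 5)] (hr : W.analyticRank = 1) (hSha : ∃ s : ℚ, shaAn W = (s : ℂ) ∧ 0 < padicValRat 5 s)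
    (K : Type) [Field K] [NumberField K] (Wd : WeierstrassCurve ℚ) [Wd.IsElliptic] [Wd.IsGloballyMinimal] (Cd : VariableChange ℚ)
    (hK : IsImaginaryQuadratic K) (hH : SatisfiesHeegnerHypothesis (W.conductorNorm ℤ) K)
    (hL : (W.quadraticTwist (NumberField.discr K : ℚ)).entireLFunction 1 ≠ 0)
    (hCd : Cd • W.quadraticTwist (NumberField.discr K : ℚ) = Wd)
    (hXd : ClassX11a Wd 5) (hnsd : ¬ Surj Wd 5)
    (hvd : (5 : ℕ) ∣ padicValInt 5 Wd.minimalDiscriminantInt)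
    {N : ℕ} [NeZero N] (f : CuspForm (CongruenceSubgroup.Gamma0 N) 2) (hf : ModularForms.IsNewformOf Wd f)
    (ϖ : ℚ) (hϖ : (ϖ : ℝ) * Wd.realPeriodRat = ModularForms.plusPeriod f)
    (a : ℚ_[5]) (L : PowerSeries ℚ_[5])
    (ha₁ : Wd.HasSplitMultiplicativeReductionAtPrime 5 → a = 1) (ha₂ : ¬ Wd.HasSplitMultiplicativeReductionAtPrime 5 → a = -1)
    (hLf : IsMultPAdicLFunctionOf f 5 a L) :
    ∃ n : ℕ, ‖PowerSeries.coeff n (PowerSeries.C ((ϖ : ℚ) : ℚ_[5]) * L)‖ = 1 := by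
  obtain ⟨hX, hns, h57, hv, hram, hs⟩ := deepHypotheses W hW hr hSha
  exact h W 5 hX hns h57 hv hram hs K Wd Cd hK hH hL hCd hXd hnsd hvd f hf ϖ hϖ a L ha₁ ha₂ hLf

end Tm231o115d94

end Summit.BirchSwinnertonDyer.BirchSwinnertonDyer.Theorems.CornerFive

end
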